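import Mathlib.MeasureTheory.Integral.Bochner.Basic
import HarnessLib

/-!
# Crux `FluctuationComparisonRegPrIntL` (stmt-QuantumFields-20520, rung R3), PATH-B organ, JENSEN SIDE:
# **THE VARIANCE REBRACKET** — the exact identity behind the Jensen knit `SpreadFibreLawHJ → JVARᵘ-H″` in CUMULANT FORM
# (LEAD w3 g26 DESIGN CALL №33 «(HV′) = cumulant form, t-uniform letters, law normalisation»; design px5 g20 (F1)(F2); LEAD №5 «brick (b): px5 g20 GO»)

Cell `ym3-torus` (rung R3 = continuum `SU(2)` Yang–Mills on T³ — NOT d = 4, NOT infinite volume, NOT a mass gap, NOT Clay), width copy `ym3-torus-px5` (gen 20).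
`--kind proof --supports stmt-QuantumFields-20520 --as helper`, count-neutral, DEFINITION-FREE, Mathlib-only, default heartbeats, `autoImplicit false`;
THEOREMS ONLY on ONE abstract fibre `(Ω, P)`; no registry ∕ binder ∕ `Lines/` edit.

WHAT.  On one fibre `(Ω, P)` take four observables `F_U F_V F_W F_Y` (the seed discrepancy read through the chart at the four corners of a datum square) and four
weights `ŵ_U ŵ_V ŵ_W ŵ_Y` (the fibre laws over the four corners, as densities w.r.t. `P`), and the nine «law-centred second moments»
`𝒱(a,c) := ∫ (F_a − c_{ac})²·ŵ_c dP` for the pairs `(a,c)` with `a = c` or `c = Y` or `a = U`.  When `c_{ac} = ∫ F_a·ŵ_c` these are the VARIANCES of `F_a` under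
the law `ŵ_c`, and the diagonal `𝒱(X,X)` is the Jensen side's object `A_t(X)`.  The file proves, with NO analysis (integrability-only currency: no sup letter, no
measurability hypothesis beyond `Integrable`):
* §1 three pointwise∕one-law identities — `sq_sub_sq_centred` (difference of two centred squares = «first difference × centred sum», the (JV3-h′) integrand),
  `integral_centred_sq_weight` (a centred square is integrable from `ŵ, F·ŵ, F²·ŵ`), `fibreVar_lawEdge_eq` (`𝒱(V,c) − 𝒱(U,c)` = ONE integral of the (JV3-h′) integrand);
* §2 `fibreVar_transport_eq` — at ONE law `ŵ_Y` with its own centrings: `𝒱(Y,Y) − 𝒱(V,Y) − 𝒱(W,Y) + 𝒱(U,Y) = Σ_{X} ± ∫ ΔΔF·(F_X − c_{XY})·ŵ_Y + 2·∫ (Δ₁F − Δ₁c)(Δ₂F − Δ₂c)·ŵ_Y`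
  (covariance polarisation; the mean terms die by the NORMALISATION `∫ ŵ_Y = 1` — the (JV0-h) conjunct of (HV′));
* §3 ★★`fibreVar_rebracket` — LEAD's `rebracket` (✓`LinKnit_LEAD` :116, a ring identity in nine reals) at `I a c := 𝒱(a,c)` composed with §1–§2:
  `𝒱(Y,Y) − 𝒱(V,V) − 𝒱(W,W) + 𝒱(U,U) = ⟨(JV1-h)×4 + 2·(JV2-h) at law Y⟩ + ⟨(JV3-h′) pair: laws Y vs V, observables V∕U⟩ + ⟨mirror: laws Y vs W, observables W∕U⟩
  + ⟨(JV4-h′): observable U, laws Y V W U⟩`, every integrand spelled as in the (HV′) block v0.2 (ws16 6b64e12142fdd076) so the knit rewrites by it;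
* §4 ★★★`abs_fibreVar_secondDiff_le` — the BOUND FORM the knit applies: bracket bounds `K1Y K1V K1W K1U K2 K3 K3' K4` ⟹ `|ΔΔ_diag 𝒱| ≤ ΣK1 + 2K2 + K3 + K3' + K4`.
WHY THIS FORM (px5 g20 DESIGN NOTE (F2), LEAD №33): every bracket on the right is centred at ITS OWN integrating law, hence a CUMULANT-type object (covariance,
law-response of a covariance, second law-response of a variance) that the discharger can bound with a decaying kernel; the own-OBSERVABLE-law centring of
✓`…FibreVarianceSquareKnit.fibreVar_secondDiff_eq` (same value on the diagonal) distributes the non-decaying product `2·a(B)·a′(B′)` of first-order MEAN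
responses over its four pieces — harmless as an identity, fatal as a bracket design.  No mean∕(H) bracket appears: the variance is shift-invariant.

HONEST FRAMING: integral identities over HYPOTHESIS data ([folklore]); transports ∕ weights ∕ letters NOT constructed; nothing of Bałaban's analysis is
asserted or proved; `SpreadFibreLawHJ`, JVARᵘ-H″, JENᵘ-H″, LINᵘ-H″, O1ᵘ-H v2.2, S1aᴴ, crux 20520, `YM3TorusSU2` are NOT proved; registry
`Lines/semiclassical_s2beta.lean` and `Lines/runpair_organ.lean` untouched, nothing here is registered; rung R3 = SU(2) YM₃ on T³ — NOT d = 4, NOT infinite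
volume, NOT a mass gap, NOT Clay; the Yang–Mills mass gap is NOT proved by any of this.  Credit: LEAD w3 g25∕g26 (`rebracket`, R1–R5), ideator g28 (HJ frame).
-/

set_option autoImplicit false

noncomputable section

namespace Summit.QuantumFields.YangMills.Theorems.FluctuationComparisonRegPrIntLOrganTangentFibreVarianceRebracket

open MeasureTheory

variable {Ω : Type*} [MeasurableSpace Ω]

/-! ## §1 One law: centred squares -/

/-- Difference of two centred squares = «first difference, centred» × «sum, centred» (the (JV3-h′) integrand), pointwise. [folklore] -/
theorem sq_sub_sq_centred (x y a b : ℝ) :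
    (x - a) ^ 2 - (y - b) ^ 2 = ((x - y) - (a - b)) * ((x + y) - (a + b)) := by
  ring

/-- A centred square against a weight is integrable from `ŵ`, `F·ŵ`, `F²·ŵ` (no measurability letter: it is the linear combination
`F²ŵ − 2c·Fŵ + c²·ŵ`). [folklore] -/
theorem integrable_centred_sq_weight (P : Measure Ω) (F w : Ω → ℝ) (c : ℝ)
    (hw : Integrable w P) (hF : Integrable (fun ξ => F ξ * w ξ) P) (hF2 : Integrable (fun ξ => F ξ ^ 2 * w ξ) P) :
    Integrable (fun ξ => (F ξ - c) ^ 2 * w ξ) P := by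
  have h : (fun ξ => (F ξ - c) ^ 2 * w ξ) = fun ξ => (F ξ ^ 2 * w ξ - (2 * c) * (F ξ * w ξ)) + c ^ 2 * w ξ := by
    funext ξ; ring
  rw [h]
  exact (hF2.sub (hF.const_mul _)).add (hw.const_mul _)

/-- The value of a centred square's integral in the three basic integrals. [folklore] -/
theorem integral_centred_sq_weight (P : Measure Ω) (F w : Ω → ℝ) (c : ℝ)
    (hw : Integrable w P) (hF : Integrable (fun ξ => F ξ * w ξ) P) (hF2 : Integrable (fun ξ => F ξ ^ 2 * w ξ) P) :
    ∫ ξ, (F ξ - c) ^ 2 * w ξ ∂P = (∫ ξ, F ξ ^ 2 * w ξ ∂P) - 2 * c * (∫ ξ, F ξ * w ξ ∂P) + c ^ 2 * ∫ ξ, w ξ ∂P := by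
  have h : (fun ξ => (F ξ - c) ^ 2 * w ξ) = fun ξ => (F ξ ^ 2 * w ξ - (2 * c) * (F ξ * w ξ)) + c ^ 2 * w ξ := by
    funext ξ; ring
  have h1 : Integrable (fun ξ => F ξ ^ 2 * w ξ - (2 * c) * (F ξ * w ξ)) P := hF2.sub (hF.const_mul _)
  have h2 : Integrable (fun ξ => (2 * c) * (F ξ * w ξ)) P := hF.const_mul _
  have h3 : Integrable (fun ξ => c ^ 2 * w ξ) P := hw.const_mul _
  rw [h, integral_add h1 h3, integral_sub hF2 h2, integral_const_mul, integral_const_mul]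

/-- ONE LAW EDGE OF THE OBSERVABLE at a fixed law `ŵ`: `𝒱(V,ŵ) − 𝒱(U,ŵ)` is ONE integral of the (JV3-h′) integrand
`((F_V − F_U) − (c_V − c_U))·((F_V + F_U) − (c_V + c_U))·ŵ` (any constants `c_V c_U`). [folklore] -/
theorem fibreVar_lawEdge_eq (P : Measure Ω) (FV FU w : Ω → ℝ) (cV cU : ℝ)
    (hw : Integrable w P) (hV : Integrable (fun ξ => FV ξ * w ξ) P) (hV2 : Integrable (fun ξ => FV ξ ^ 2 * w ξ) P)
    (hU : Integrable (fun ξ => FU ξ * w ξ) P) (hU2 : Integrable (fun ξ => FU ξ ^ 2 * w ξ) P) :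
    (∫ ξ, (FV ξ - cV) ^ 2 * w ξ ∂P) - (∫ ξ, (FU ξ - cU) ^ 2 * w ξ ∂P)
      = ∫ ξ, ((FV ξ - FU ξ) - (cV - cU)) * ((FV ξ + FU ξ) - (cV + cU)) * w ξ ∂P := by
  rw [← integral_sub (integrable_centred_sq_weight P FV w cV hw hV hV2) (integrable_centred_sq_weight P FU w cU hw hU hU2)]
  refine integral_congr_ae (Filter.Eventually.of_forall fun ξ => ?_)
  beta_reduce
  ring

/-- The (JV3-h′) integrand is integrable at any law from the basics (so the cross brackets' own `Integrable` conjuncts are consequences). [folklore] -/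
theorem integrable_lawEdge (P : Measure Ω) (FV FU w : Ω → ℝ) (cV cU : ℝ)
    (hw : Integrable w P) (hV : Integrable (fun ξ => FV ξ * w ξ) P) (hV2 : Integrable (fun ξ => FV ξ ^ 2 * w ξ) P)
    (hU : Integrable (fun ξ => FU ξ * w ξ) P) (hU2 : Integrable (fun ξ => FU ξ ^ 2 * w ξ) P) :
    Integrable (fun ξ => ((FV ξ - FU ξ) - (cV - cU)) * ((FV ξ + FU ξ) - (cV + cU)) * w ξ) P := by
  have h : (fun ξ => ((FV ξ - FU ξ) - (cV - cU)) * ((FV ξ + FU ξ) - (cV + cU)) * w ξ)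
      = fun ξ => (FV ξ - cV) ^ 2 * w ξ - (FU ξ - cU) ^ 2 * w ξ := by
    funext ξ; rw [← sub_mul, sq_sub_sq_centred]
  rw [h]
  exact (integrable_centred_sq_weight P FV w cV hw hV hV2).sub (integrable_centred_sq_weight P FU w cU hw hU hU2)

/-! ## §2 One law: the transport group (covariance polarisation) -/

/-- Second difference of four centred squares, pointwise: `(d−δ)² − (b−β)² − (c−γ)² + (a−α)²
 = (ΔΔx − ΔΔm)·((d−δ)+(b−β)+(c−γ)−(a−α)) + 2·((b−a) − (β−α))·((c−a) − (γ−α))`. [folklore] -/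
theorem sq_secondDiff_centred (a b c d α β γ δ : ℝ) :
    (d - δ) ^ 2 - (b - β) ^ 2 - (c - γ) ^ 2 + (a - α) ^ 2
      = ((d - b - c + a) - (δ - β - γ + α)) * ((d - δ) + (b - β) + (c - γ) - (a - α))
        + 2 * (((b - a) - (β - α)) * ((c - a) - (γ - α))) := by
  ring

/-- A centred observable has integral zero against a NORMALISED law centred at its own mean. [folklore] -/
theorem integral_centred_eq_zero (P : Measure Ω) (F w : Ω → ℝ) (c : ℝ)
    (hw : Integrable w P) (hF : Integrable (fun ξ => F ξ * w ξ) P) (hn : ∫ ξ, w ξ ∂P = 1) (hc : c = ∫ ξ, F ξ * w ξ ∂P) :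
    ∫ ξ, (F ξ - c) * w ξ ∂P = 0 := by
  have h : (fun ξ => (F ξ - c) * w ξ) = fun ξ => F ξ * w ξ - c * w ξ := by funext ξ; ring
  rw [h, integral_sub hF (hw.const_mul _), integral_const_mul, hn, mul_one, hc, sub_self]

/-- ★ **THE TRANSPORT GROUP AT ONE LAW** (covariance polarisation): with the law `ŵ_Y` normalised and the four centrings its own means,
`𝒱(Y,Y) − 𝒱(V,Y) − 𝒱(W,Y) + 𝒱(U,Y) = ∫ ΔΔF·(F_Y − c_Y)ŵ + ∫ ΔΔF·(F_V − c_V)ŵ + ∫ ΔΔF·(F_W − c_W)ŵ − ∫ ΔΔF·(F_U − c_U)ŵ + 2·∫ (Δ₁F − Δ₁c)(Δ₂F − Δ₂c)ŵ`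
— four (JV1-h) integrands and one (JV2-h) integrand (their integrability is taken as hypotheses, exactly the brackets' own conjuncts). [folklore] -/
theorem fibreVar_transport_eq (P : Measure Ω) (FU FV FW FY w : Ω → ℝ) (cU cV cW cY : ℝ)
    (hw : Integrable w P) (hn : ∫ ξ, w ξ ∂P = 1)
    (hU : Integrable (fun ξ => FU ξ * w ξ) P) (hU2 : Integrable (fun ξ => FU ξ ^ 2 * w ξ) P)
    (hV : Integrable (fun ξ => FV ξ * w ξ) P) (hV2 : Integrable (fun ξ => FV ξ ^ 2 * w ξ) P)
    (hW : Integrable (fun ξ => FW ξ * w ξ) P) (hW2 : Integrable (fun ξ => FW ξ ^ 2 * w ξ) P)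
    (hY : Integrable (fun ξ => FY ξ * w ξ) P) (hY2 : Integrable (fun ξ => FY ξ ^ 2 * w ξ) P)
    (hcU : cU = ∫ ξ, FU ξ * w ξ ∂P) (hcV : cV = ∫ ξ, FV ξ * w ξ ∂P) (hcW : cW = ∫ ξ, FW ξ * w ξ ∂P) (hcY : cY = ∫ ξ, FY ξ * w ξ ∂P)
    (hJ1Y : Integrable (fun ξ => (FY ξ - FV ξ - FW ξ + FU ξ) * (FY ξ - cY) * w ξ) P)
    (hJ1V : Integrable (fun ξ => (FY ξ - FV ξ - FW ξ + FU ξ) * (FV ξ - cV) * w ξ) P)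
    (hJ1W : Integrable (fun ξ => (FY ξ - FV ξ - FW ξ + FU ξ) * (FW ξ - cW) * w ξ) P)
    (hJ1U : Integrable (fun ξ => (FY ξ - FV ξ - FW ξ + FU ξ) * (FU ξ - cU) * w ξ) P)
    (hJ2 : Integrable (fun ξ => ((FV ξ - FU ξ) - (cV - cU)) * ((FW ξ - FU ξ) - (cW - cU)) * w ξ) P) :
    (∫ ξ, (FY ξ - cY) ^ 2 * w ξ ∂P) - (∫ ξ, (FV ξ - cV) ^ 2 * w ξ ∂P) - (∫ ξ, (FW ξ - cW) ^ 2 * w ξ ∂P) + (∫ ξ, (FU ξ - cU) ^ 2 * w ξ ∂P)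
      = (∫ ξ, (FY ξ - FV ξ - FW ξ + FU ξ) * (FY ξ - cY) * w ξ ∂P) + (∫ ξ, (FY ξ - FV ξ - FW ξ + FU ξ) * (FV ξ - cV) * w ξ ∂P)
        + (∫ ξ, (FY ξ - FV ξ - FW ξ + FU ξ) * (FW ξ - cW) * w ξ ∂P) - (∫ ξ, (FY ξ - FV ξ - FW ξ + FU ξ) * (FU ξ - cU) * w ξ ∂P)
        + 2 * ∫ ξ, ((FV ξ - FU ξ) - (cV - cU)) * ((FW ξ - FU ξ) - (cW - cU)) * w ξ ∂P := by
  -- the four centred squares, as integrable functions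
  have iY := integrable_centred_sq_weight P FY w cY hw hY hY2
  have iV := integrable_centred_sq_weight P FV w cV hw hV hV2
  have iW := integrable_centred_sq_weight P FW w cW hw hW hW2
  have iU := integrable_centred_sq_weight P FU w cU hw hU hU2
  -- the centred first moments vanish (normalisation + own means)
  have zY := integral_centred_eq_zero P FY w cY hw hY hn hcY
  have zV := integral_centred_eq_zero P FV w cV hw hV hn hcV
  have zW := integral_centred_eq_zero P FW w cW hw hW hn hcW
  have zU := integral_centred_eq_zero P FU w cU hw hU hn hcU
  have lY : Integrable (fun ξ => (FY ξ - cY) * w ξ) P := by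
    have := hY.sub (hw.const_mul cY); exact this.congr (Filter.Eventually.of_forall fun ξ => by simp only [Pi.sub_apply]; ring)
  have lV : Integrable (fun ξ => (FV ξ - cV) * w ξ) P := by
    have := hV.sub (hw.const_mul cV); exact this.congr (Filter.Eventually.of_forall fun ξ => by simp only [Pi.sub_apply]; ring)
  have lW : Integrable (fun ξ => (FW ξ - cW) * w ξ) P := by
    have := hW.sub (hw.const_mul cW); exact this.congr (Filter.Eventually.of_forall fun ξ => by simp only [Pi.sub_apply]; ring)
  have lU : Integrable (fun ξ => (FU ξ - cU) * w ξ) P := by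
    have := hU.sub (hw.const_mul cU); exact this.congr (Filter.Eventually.of_forall fun ξ => by simp only [Pi.sub_apply]; ring)
  -- the mean part of the pull-back: `ΔΔc · ∫ (Σ centred) ŵ = 0`
  set K : ℝ := cY - cV - cW + cU with hK
  have iS : Integrable (fun ξ => ((FY ξ - cY) + (FV ξ - cV) + (FW ξ - cW) - (FU ξ - cU)) * w ξ) P := by
    have := ((lY.add lV).add lW).sub lU
    exact this.congr (Filter.Eventually.of_forall fun ξ => by simp only [Pi.add_apply, Pi.sub_apply]; ring)
  have zS : ∫ ξ, ((FY ξ - cY) + (FV ξ - cV) + (FW ξ - cW) - (FU ξ - cU)) * w ξ ∂P = 0 := by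
    have e : (fun ξ => ((FY ξ - cY) + (FV ξ - cV) + (FW ξ - cW) - (FU ξ - cU)) * w ξ)
        = fun ξ => (((FY ξ - cY) * w ξ + (FV ξ - cV) * w ξ) + (FW ξ - cW) * w ξ) - (FU ξ - cU) * w ξ := by
      funext ξ; ring
    have a1 : Integrable (fun ξ => (FY ξ - cY) * w ξ + (FV ξ - cV) * w ξ) P := lY.add lV
    have a2 : Integrable (fun ξ => ((FY ξ - cY) * w ξ + (FV ξ - cV) * w ξ) + (FW ξ - cW) * w ξ) P := a1.add lW
    rw [e, integral_sub a2 lU, integral_add a1 lW, integral_add lY lV, zY, zV, zW, zU]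
    ring
  -- LHS as one integral, pointwise polarisation, then split
  have eL : (∫ ξ, (FY ξ - cY) ^ 2 * w ξ ∂P) - (∫ ξ, (FV ξ - cV) ^ 2 * w ξ ∂P) - (∫ ξ, (FW ξ - cW) ^ 2 * w ξ ∂P)
        + (∫ ξ, (FU ξ - cU) ^ 2 * w ξ ∂P)
      = ∫ ξ, ((FY ξ - cY) ^ 2 * w ξ - (FV ξ - cV) ^ 2 * w ξ - (FW ξ - cW) ^ 2 * w ξ + (FU ξ - cU) ^ 2 * w ξ) ∂P := by
    have s1 : Integrable (fun ξ => (FY ξ - cY) ^ 2 * w ξ - (FV ξ - cV) ^ 2 * w ξ) P := iY.sub iV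
    have s2 : Integrable (fun ξ => (FY ξ - cY) ^ 2 * w ξ - (FV ξ - cV) ^ 2 * w ξ - (FW ξ - cW) ^ 2 * w ξ) P := s1.sub iW
    rw [integral_add s2 iU, integral_sub s1 iW, integral_sub iY iV]
  rw [eL]
  have eP : (fun ξ => (FY ξ - cY) ^ 2 * w ξ - (FV ξ - cV) ^ 2 * w ξ - (FW ξ - cW) ^ 2 * w ξ + (FU ξ - cU) ^ 2 * w ξ)
      = fun ξ => ((((FY ξ - FV ξ - FW ξ + FU ξ) * (FY ξ - cY) * w ξ + (FY ξ - FV ξ - FW ξ + FU ξ) * (FV ξ - cV) * w ξ)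
            + (FY ξ - FV ξ - FW ξ + FU ξ) * (FW ξ - cW) * w ξ) - (FY ξ - FV ξ - FW ξ + FU ξ) * (FU ξ - cU) * w ξ)
          + 2 * (((FV ξ - FU ξ) - (cV - cU)) * ((FW ξ - FU ξ) - (cW - cU)) * w ξ)
          - K * (((FY ξ - cY) + (FV ξ - cV) + (FW ξ - cW) - (FU ξ - cU)) * w ξ) := by
    funext ξ; rw [hK]; ring
  have t1 : Integrable (fun ξ => (FY ξ - FV ξ - FW ξ + FU ξ) * (FY ξ - cY) * w ξ
      + (FY ξ - FV ξ - FW ξ + FU ξ) * (FV ξ - cV) * w ξ) P := hJ1Y.add hJ1V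
  have t2 : Integrable (fun ξ => ((FY ξ - FV ξ - FW ξ + FU ξ) * (FY ξ - cY) * w ξ
      + (FY ξ - FV ξ - FW ξ + FU ξ) * (FV ξ - cV) * w ξ) + (FY ξ - FV ξ - FW ξ + FU ξ) * (FW ξ - cW) * w ξ) P := t1.add hJ1W
  have t3 : Integrable (fun ξ => (((FY ξ - FV ξ - FW ξ + FU ξ) * (FY ξ - cY) * w ξ
      + (FY ξ - FV ξ - FW ξ + FU ξ) * (FV ξ - cV) * w ξ) + (FY ξ - FV ξ - FW ξ + FU ξ) * (FW ξ - cW) * w ξ)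
      - (FY ξ - FV ξ - FW ξ + FU ξ) * (FU ξ - cU) * w ξ) P := t2.sub hJ1U
  have t4 : Integrable (fun ξ => 2 * (((FV ξ - FU ξ) - (cV - cU)) * ((FW ξ - FU ξ) - (cW - cU)) * w ξ)) P := hJ2.const_mul 2
  have t5 : Integrable (fun ξ => ((((FY ξ - FV ξ - FW ξ + FU ξ) * (FY ξ - cY) * w ξ
      + (FY ξ - FV ξ - FW ξ + FU ξ) * (FV ξ - cV) * w ξ) + (FY ξ - FV ξ - FW ξ + FU ξ) * (FW ξ - cW) * w ξ)
      - (FY ξ - FV ξ - FW ξ + FU ξ) * (FU ξ - cU) * w ξ)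
      + 2 * (((FV ξ - FU ξ) - (cV - cU)) * ((FW ξ - FU ξ) - (cW - cU)) * w ξ)) P := t3.add t4
  have t6 : Integrable (fun ξ => K * (((FY ξ - cY) + (FV ξ - cV) + (FW ξ - cW) - (FU ξ - cU)) * w ξ)) P := iS.const_mul K
  rw [eP, integral_sub t5 t6, integral_add t3 t4, integral_sub t2 hJ1U, integral_add t1 hJ1W,
    integral_add hJ1Y hJ1V, integral_const_mul, integral_const_mul, zS, mul_zero, sub_zero]

/-! ## §3 The rebracket -/

/-- LEAD's four-corner re-bracketing (✓`LinKnit_LEAD` `rebracket`), a RING identity in nine reals `I a c`. [folklore] -/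
theorem fourCorner_rebracket (IYY IVV IWW IUU IVY IWY IUY IUV IUW : ℝ) :
    IYY - IVV - IWW + IUU = (IYY - IVY - IWY + IUY) + ((IVY - IUY) - (IVV - IUV)) + ((IWY - IUY) - (IWW - IUW))
      + (IUY - IUV - IUW + IUU) := by ring

/-- ★★ **THE VARIANCE REBRACKET** (cumulant form of the Jensen side; see the module docstring).  Data: four observables `F_U F_V F_W F_Y`, four weights
`ŵ_U ŵ_V ŵ_W ŵ_Y` with `ŵ_Y` NORMALISED, nine centring constants of which the four at law `Y` are the `ŵ_Y`-means (the other five are free — in the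
knit, the own means too).  Hypotheses = the (JV0-h) conjuncts (`Integrable ŵ`, `F·ŵ`, `F²·ŵ` for the nine pairs used) + the (JV1-h)×4 and (JV2-h)
product integrabilities at law `Y`.  Conclusion: the second difference of the DIAGONAL law-centred second moments equals
TRANSPORT (four (JV1-h) + twice (JV2-h), law `Y`) + CROSS (the (JV3-h′) pair: observables `V∕U`, laws `Y` then `V`) + MIRROR (observables `W∕U`, laws
`Y` then `W`) + CENTRED (the (JV4-h′) four: observable `U`, laws `Y V W U`), every integrand spelled as in (HV′) v0.2. [folklore] -/
theorem fibreVar_rebracket (P : Measure Ω) (FU FV FW FY wU wV wW wY : Ω → ℝ)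
    (cUU cUV cUW cUY cVV cVY cWW cWY cYY : ℝ)
    -- (JV0-h): the weights, first and second moments used (the diagonal `𝒱(U,U)` is carried, so `ŵ_U`'s are not needed)
    (hwV : Integrable wV P) (hwW : Integrable wW P) (hwY : Integrable wY P) (hnY : ∫ ξ, wY ξ ∂P = 1)
    (hUV : Integrable (fun ξ => FU ξ * wV ξ) P) (hUV2 : Integrable (fun ξ => FU ξ ^ 2 * wV ξ) P)
    (hUW : Integrable (fun ξ => FU ξ * wW ξ) P) (hUW2 : Integrable (fun ξ => FU ξ ^ 2 * wW ξ) P)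
    (hUY : Integrable (fun ξ => FU ξ * wY ξ) P) (hUY2 : Integrable (fun ξ => FU ξ ^ 2 * wY ξ) P)
    (hVV : Integrable (fun ξ => FV ξ * wV ξ) P) (hVV2 : Integrable (fun ξ => FV ξ ^ 2 * wV ξ) P)
    (hVY : Integrable (fun ξ => FV ξ * wY ξ) P) (hVY2 : Integrable (fun ξ => FV ξ ^ 2 * wY ξ) P)
    (hWW : Integrable (fun ξ => FW ξ * wW ξ) P) (hWW2 : Integrable (fun ξ => FW ξ ^ 2 * wW ξ) P)
    (hWY : Integrable (fun ξ => FW ξ * wY ξ) P) (hWY2 : Integrable (fun ξ => FW ξ ^ 2 * wY ξ) P)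
    (hYY : Integrable (fun ξ => FY ξ * wY ξ) P) (hYY2 : Integrable (fun ξ => FY ξ ^ 2 * wY ξ) P)
    -- the four centrings at law `Y` are the `ŵ_Y`-means
    (hcUY : cUY = ∫ ξ, FU ξ * wY ξ ∂P) (hcVY : cVY = ∫ ξ, FV ξ * wY ξ ∂P) (hcWY : cWY = ∫ ξ, FW ξ * wY ξ ∂P)
    (hcYY : cYY = ∫ ξ, FY ξ * wY ξ ∂P)
    -- (JV1-h)×4 and (JV2-h): the product integrands at law `Y`
    (hJ1Y : Integrable (fun ξ => (FY ξ - FV ξ - FW ξ + FU ξ) * (FY ξ - cYY) * wY ξ) P)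
    (hJ1V : Integrable (fun ξ => (FY ξ - FV ξ - FW ξ + FU ξ) * (FV ξ - cVY) * wY ξ) P)
    (hJ1W : Integrable (fun ξ => (FY ξ - FV ξ - FW ξ + FU ξ) * (FW ξ - cWY) * wY ξ) P)
    (hJ1U : Integrable (fun ξ => (FY ξ - FV ξ - FW ξ + FU ξ) * (FU ξ - cUY) * wY ξ) P)
    (hJ2 : Integrable (fun ξ => ((FV ξ - FU ξ) - (cVY - cUY)) * ((FW ξ - FU ξ) - (cWY - cUY)) * wY ξ) P) :
    (∫ ξ, (FY ξ - cYY) ^ 2 * wY ξ ∂P) - (∫ ξ, (FV ξ - cVV) ^ 2 * wV ξ ∂P) - (∫ ξ, (FW ξ - cWW) ^ 2 * wW ξ ∂P)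
        + (∫ ξ, (FU ξ - cUU) ^ 2 * wU ξ ∂P)
      = ((∫ ξ, (FY ξ - FV ξ - FW ξ + FU ξ) * (FY ξ - cYY) * wY ξ ∂P) + (∫ ξ, (FY ξ - FV ξ - FW ξ + FU ξ) * (FV ξ - cVY) * wY ξ ∂P)
          + (∫ ξ, (FY ξ - FV ξ - FW ξ + FU ξ) * (FW ξ - cWY) * wY ξ ∂P) - (∫ ξ, (FY ξ - FV ξ - FW ξ + FU ξ) * (FU ξ - cUY) * wY ξ ∂P)
          + 2 * ∫ ξ, ((FV ξ - FU ξ) - (cVY - cUY)) * ((FW ξ - FU ξ) - (cWY - cUY)) * wY ξ ∂P)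
        + ((∫ ξ, ((FV ξ - FU ξ) - (cVY - cUY)) * ((FV ξ + FU ξ) - (cVY + cUY)) * wY ξ ∂P)
            - (∫ ξ, ((FV ξ - FU ξ) - (cVV - cUV)) * ((FV ξ + FU ξ) - (cVV + cUV)) * wV ξ ∂P))
        + ((∫ ξ, ((FW ξ - FU ξ) - (cWY - cUY)) * ((FW ξ + FU ξ) - (cWY + cUY)) * wY ξ ∂P)
            - (∫ ξ, ((FW ξ - FU ξ) - (cWW - cUW)) * ((FW ξ + FU ξ) - (cWW + cUW)) * wW ξ ∂P))
        + ((∫ ξ, (FU ξ - cUY) ^ 2 * wY ξ ∂P) - (∫ ξ, (FU ξ - cUV) ^ 2 * wV ξ ∂P) - (∫ ξ, (FU ξ - cUW) ^ 2 * wW ξ ∂P)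
            + (∫ ξ, (FU ξ - cUU) ^ 2 * wU ξ ∂P)) := by
  rw [fourCorner_rebracket (∫ ξ, (FY ξ - cYY) ^ 2 * wY ξ ∂P) (∫ ξ, (FV ξ - cVV) ^ 2 * wV ξ ∂P) (∫ ξ, (FW ξ - cWW) ^ 2 * wW ξ ∂P)
    (∫ ξ, (FU ξ - cUU) ^ 2 * wU ξ ∂P) (∫ ξ, (FV ξ - cVY) ^ 2 * wY ξ ∂P) (∫ ξ, (FW ξ - cWY) ^ 2 * wY ξ ∂P)
    (∫ ξ, (FU ξ - cUY) ^ 2 * wY ξ ∂P) (∫ ξ, (FU ξ - cUV) ^ 2 * wV ξ ∂P) (∫ ξ, (FU ξ - cUW) ^ 2 * wW ξ ∂P)]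
  rw [fibreVar_transport_eq P FU FV FW FY wY cUY cVY cWY cYY hwY hnY hUY hUY2 hVY hVY2 hWY hWY2 hYY hYY2 hcUY hcVY hcWY hcYY
    hJ1Y hJ1V hJ1W hJ1U hJ2,
    fibreVar_lawEdge_eq P FV FU wY cVY cUY hwY hVY hVY2 hUY hUY2, fibreVar_lawEdge_eq P FV FU wV cVV cUV hwV hVV hVV2 hUV hUV2,
    fibreVar_lawEdge_eq P FW FU wY cWY cUY hwY hWY hWY2 hUY hUY2, fibreVar_lawEdge_eq P FW FU wW cWW cUW hwW hWW hWW2 hUW hUW2]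

/-! ## §4 The bound form (what the knit applies) -/

/-- kernel: the triangle inequality behind the bound form — eight bracket bounds add up. [folklore] -/
theorem abs_rebracket_le {a b c d e f g h K1Y K1V K1W K1U K2 K3 K3' K4 : ℝ}
    (ha : |a| ≤ K1Y) (hb : |b| ≤ K1V) (hc : |c| ≤ K1W) (hd : |d| ≤ K1U) (he : |e| ≤ K2)
    (hf : |f| ≤ K3) (hg : |g| ≤ K3') (hh : |h| ≤ K4) :
    |(a + b + c - d + 2 * e) + f + g + h| ≤ K1Y + K1V + K1W + K1U + 2 * K2 + K3 + K3' + K4 := by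
  have h1 : |(a + b + c - d + 2 * e) + f + g + h| ≤ |(a + b + c - d + 2 * e) + f + g| + |h| := abs_add_le _ _
  have h2 : |(a + b + c - d + 2 * e) + f + g| ≤ |(a + b + c - d + 2 * e) + f| + |g| := abs_add_le _ _
  have h3 : |(a + b + c - d + 2 * e) + f| ≤ |a + b + c - d + 2 * e| + |f| := abs_add_le _ _
  have h4 : |a + b + c - d + 2 * e| ≤ |a + b + c - d| + |2 * e| := abs_add_le _ _
  have h5 : |a + b + c - d| ≤ |a + b + c| + |d| := abs_sub _ _
  have h6 : |a + b + c| ≤ |a + b| + |c| := abs_add_le _ _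
  have h7 : |a + b| ≤ |a| + |b| := abs_add_le _ _
  have h8 : |2 * e| = 2 * |e| := by rw [abs_mul, abs_two]
  linarith

/-- ★★★ **THE VARIANCE REBRACKET, BOUND FORM** — `fibreVar_rebracket` followed by the triangle inequality: if the four (JV1-h) integrals at law `Y`
are bounded by `K1Y K1V K1W K1U`, the (JV2-h) integral by `K2`, the (JV3-h′) pair (laws `Y` vs `V`) by `K3`, its mirror (laws `Y` vs `W`) by `K3'` and
the (JV4-h′) four by `K4`, then `|𝒱(Y,Y) − 𝒱(V,V) − 𝒱(W,W) + 𝒱(U,U)| ≤ K1Y + K1V + K1W + K1U + 2·K2 + K3 + K3' + K4` (in the knit: `(4kV₁ + 2kV₂ + kV₃ +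
2kV₃ᵀ + kV₄)·sz·sz′`).  Same hypotheses and integrand spellings as `fibreVar_rebracket`. [folklore] -/
theorem abs_fibreVar_secondDiff_le (P : Measure Ω) (FU FV FW FY wU wV wW wY : Ω → ℝ)
    (cUU cUV cUW cUY cVV cVY cWW cWY cYY K1Y K1V K1W K1U K2 K3 K3' K4 : ℝ)
    (hwV : Integrable wV P) (hwW : Integrable wW P) (hwY : Integrable wY P) (hnY : ∫ ξ, wY ξ ∂P = 1)
    (hUV : Integrable (fun ξ => FU ξ * wV ξ) P) (hUV2 : Integrable (fun ξ => FU ξ ^ 2 * wV ξ) P)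
    (hUW : Integrable (fun ξ => FU ξ * wW ξ) P) (hUW2 : Integrable (fun ξ => FU ξ ^ 2 * wW ξ) P)
    (hUY : Integrable (fun ξ => FU ξ * wY ξ) P) (hUY2 : Integrable (fun ξ => FU ξ ^ 2 * wY ξ) P)
    (hVV : Integrable (fun ξ => FV ξ * wV ξ) P) (hVV2 : Integrable (fun ξ => FV ξ ^ 2 * wV ξ) P)
    (hVY : Integrable (fun ξ => FV ξ * wY ξ) P) (hVY2 : Integrable (fun ξ => FV ξ ^ 2 * wY ξ) P)
    (hWW : Integrable (fun ξ => FW ξ * wW ξ) P) (hWW2 : Integrable (fun ξ => FW ξ ^ 2 * wW ξ) P)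
    (hWY : Integrable (fun ξ => FW ξ * wY ξ) P) (hWY2 : Integrable (fun ξ => FW ξ ^ 2 * wY ξ) P)
    (hYY : Integrable (fun ξ => FY ξ * wY ξ) P) (hYY2 : Integrable (fun ξ => FY ξ ^ 2 * wY ξ) P)
    (hcUY : cUY = ∫ ξ, FU ξ * wY ξ ∂P) (hcVY : cVY = ∫ ξ, FV ξ * wY ξ ∂P) (hcWY : cWY = ∫ ξ, FW ξ * wY ξ ∂P)
    (hcYY : cYY = ∫ ξ, FY ξ * wY ξ ∂P)
    (hJ1Y : Integrable (fun ξ => (FY ξ - FV ξ - FW ξ + FU ξ) * (FY ξ - cYY) * wY ξ) P)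
    (hJ1V : Integrable (fun ξ => (FY ξ - FV ξ - FW ξ + FU ξ) * (FV ξ - cVY) * wY ξ) P)
    (hJ1W : Integrable (fun ξ => (FY ξ - FV ξ - FW ξ + FU ξ) * (FW ξ - cWY) * wY ξ) P)
    (hJ1U : Integrable (fun ξ => (FY ξ - FV ξ - FW ξ + FU ξ) * (FU ξ - cUY) * wY ξ) P)
    (hJ2 : Integrable (fun ξ => ((FV ξ - FU ξ) - (cVY - cUY)) * ((FW ξ - FU ξ) - (cWY - cUY)) * wY ξ) P)
    -- the bracket bounds
    (bJ1Y : |∫ ξ, (FY ξ - FV ξ - FW ξ + FU ξ) * (FY ξ - cYY) * wY ξ ∂P| ≤ K1Y)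
    (bJ1V : |∫ ξ, (FY ξ - FV ξ - FW ξ + FU ξ) * (FV ξ - cVY) * wY ξ ∂P| ≤ K1V)
    (bJ1W : |∫ ξ, (FY ξ - FV ξ - FW ξ + FU ξ) * (FW ξ - cWY) * wY ξ ∂P| ≤ K1W)
    (bJ1U : |∫ ξ, (FY ξ - FV ξ - FW ξ + FU ξ) * (FU ξ - cUY) * wY ξ ∂P| ≤ K1U)
    (bJ2 : |∫ ξ, ((FV ξ - FU ξ) - (cVY - cUY)) * ((FW ξ - FU ξ) - (cWY - cUY)) * wY ξ ∂P| ≤ K2)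
    (bJ3 : |(∫ ξ, ((FV ξ - FU ξ) - (cVY - cUY)) * ((FV ξ + FU ξ) - (cVY + cUY)) * wY ξ ∂P)
            - (∫ ξ, ((FV ξ - FU ξ) - (cVV - cUV)) * ((FV ξ + FU ξ) - (cVV + cUV)) * wV ξ ∂P)| ≤ K3)
    (bJ3' : |(∫ ξ, ((FW ξ - FU ξ) - (cWY - cUY)) * ((FW ξ + FU ξ) - (cWY + cUY)) * wY ξ ∂P)
            - (∫ ξ, ((FW ξ - FU ξ) - (cWW - cUW)) * ((FW ξ + FU ξ) - (cWW + cUW)) * wW ξ ∂P)| ≤ K3')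
    (bJ4 : |(∫ ξ, (FU ξ - cUY) ^ 2 * wY ξ ∂P) - (∫ ξ, (FU ξ - cUV) ^ 2 * wV ξ ∂P) - (∫ ξ, (FU ξ - cUW) ^ 2 * wW ξ ∂P)
            + (∫ ξ, (FU ξ - cUU) ^ 2 * wU ξ ∂P)| ≤ K4) :
    |(∫ ξ, (FY ξ - cYY) ^ 2 * wY ξ ∂P) - (∫ ξ, (FV ξ - cVV) ^ 2 * wV ξ ∂P) - (∫ ξ, (FW ξ - cWW) ^ 2 * wW ξ ∂P)
        + (∫ ξ, (FU ξ - cUU) ^ 2 * wU ξ ∂P)| ≤ K1Y + K1V + K1W + K1U + 2 * K2 + K3 + K3' + K4 := by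
  rw [fibreVar_rebracket P FU FV FW FY wU wV wW wY cUU cUV cUW cUY cVV cVY cWW cWY cYY hwV hwW hwY hnY
    hUV hUV2 hUW hUW2 hUY hUY2 hVV hVV2 hVY hVY2 hWW hWW2 hWY hWY2 hYY hYY2 hcUY hcVY hcWY hcYY hJ1Y hJ1V hJ1W hJ1U hJ2]
  exact abs_rebracket_le bJ1Y bJ1V bJ1W bJ1U bJ2 bJ3 bJ3' bJ4

/-! ## §5 The bound form in LEAD's «explicit means» spelling (v1.2 append; the Jensen knit's `abs_varSecondDiff_le` twin) -/

/-- kernel: `∫ (f − g)·w = ∫ f·w − ∫ g·w` and `∫ (f + g)·w = ∫ f·w + ∫ g·w` in the product spelling. [folklore] -/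
theorem integral_sub_mul_wgt (P : Measure Ω) (f g w : Ω → ℝ)
    (hf : Integrable (fun ξ => f ξ * w ξ) P) (hg : Integrable (fun ξ => g ξ * w ξ) P) :
    ∫ ξ, (f ξ - g ξ) * w ξ ∂P = (∫ ξ, f ξ * w ξ ∂P) - ∫ ξ, g ξ * w ξ ∂P := by
  rw [← integral_sub hf hg]
  exact integral_congr_ae (Filter.Eventually.of_forall fun ξ => by beta_reduce; ring)

/-- kernel: the additive companion of `integral_sub_mul_wgt`. [folklore] -/
theorem integral_add_mul_wgt (P : Measure Ω) (f g w : Ω → ℝ)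
    (hf : Integrable (fun ξ => f ξ * w ξ) P) (hg : Integrable (fun ξ => g ξ * w ξ) P) :
    ∫ ξ, (f ξ + g ξ) * w ξ ∂P = (∫ ξ, f ξ * w ξ ∂P) + ∫ ξ, g ξ * w ξ ∂P := by
  rw [← integral_add hf hg]
  exact integral_congr_ae (Filter.Eventually.of_forall fun ξ => by beta_reduce; ring)

/-- ★★★ **THE VARIANCE REBRACKET, BOUND FORM, «EXPLICIT MEANS» SPELLING** — `abs_fibreVar_secondDiff_le` with every centring written as the
integral `∫ g·ŵ_c` it is (no letters), the four (JV1-h) bounds under ONE constant `K₁` packed as a `∀ g ∈ {f_U, f_V, f_W, f_Y}` clause, and the (JV2-h)∕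
(JV3-h′) centrings in the DIFFERENCE∕SUM spelling `∫ (f_V − f_U)·ŵ`, `∫ (f_V + f_U)·ŵ` that the (HV′) text produces — i.e. LEAD w3 g26's workfile lemma
`JvarKnit.abs_varSecondDiff_le` (v0_1 aae10dca :148) BINDER FOR BINDER, so the Theorems-side Jensen knit imports this instead of a private copy.
Conclusion: `|ΔΔ_diag Var| ≤ 4·K₁ + 2·K₂ + K₃ + K₃′ + K₄`. [folklore] -/
theorem abs_fibreVar_secondDiff_le_means (τ : Measure Ω) (fU fV fW fY wU wV wW wY : Ω → ℝ) (K₁ K₂ K₃ K₃' K₄ : ℝ)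
    -- law Y: normalisation and moments of all four observables
    (hwY : Integrable wY τ) (hwY1 : ∫ z, wY z ∂τ = 1)
    (hUY : Integrable (fun z => fU z * wY z) τ) (hUY2 : Integrable (fun z => fU z ^ 2 * wY z) τ)
    (hVY : Integrable (fun z => fV z * wY z) τ) (hVY2 : Integrable (fun z => fV z ^ 2 * wY z) τ)
    (hWY : Integrable (fun z => fW z * wY z) τ) (hWY2 : Integrable (fun z => fW z ^ 2 * wY z) τ)
    (hYY : Integrable (fun z => fY z * wY z) τ) (hYY2 : Integrable (fun z => fY z ^ 2 * wY z) τ)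
    -- law V: moments of fU, fV
    (hwV : Integrable wV τ)
    (hUV : Integrable (fun z => fU z * wV z) τ) (hUV2 : Integrable (fun z => fU z ^ 2 * wV z) τ)
    (hVV : Integrable (fun z => fV z * wV z) τ) (hVV2 : Integrable (fun z => fV z ^ 2 * wV z) τ)
    -- law W: moments of fU, fW
    (hwW : Integrable wW τ)
    (hUW : Integrable (fun z => fU z * wW z) τ) (hUW2 : Integrable (fun z => fU z ^ 2 * wW z) τ)
    (hWW : Integrable (fun z => fW z * wW z) τ) (hWW2 : Integrable (fun z => fW z ^ 2 * wW z) τ)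
    -- (JV1) at law Y, the four corners
    (hA : ∀ g : Ω → ℝ, (g = fU ∨ g = fV ∨ g = fW ∨ g = fY) →
      Integrable (fun z => (fY z - fV z - fW z + fU z) * (g z - ∫ z', g z' * wY z' ∂τ) * wY z) τ ∧
      |∫ z, (fY z - fV z - fW z + fU z) * (g z - ∫ z', g z' * wY z' ∂τ) * wY z ∂τ| ≤ K₁)
    -- (JV2) at law Y
    (hB : Integrable (fun z => ((fV z - fU z) - ∫ z', (fV z' - fU z') * wY z' ∂τ)
        * ((fW z - fU z) - ∫ z', (fW z' - fU z') * wY z' ∂τ) * wY z) τ ∧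
      |∫ z, ((fV z - fU z) - ∫ z', (fV z' - fU z') * wY z' ∂τ)
        * ((fW z - fU z) - ∫ z', (fW z' - fU z') * wY z' ∂τ) * wY z ∂τ| ≤ K₂)
    -- (JV3′): transport edge U→V against the law edge V→Y
    (hC : |(∫ z, ((fV z - fU z) - ∫ z', (fV z' - fU z') * wY z' ∂τ) * ((fV z + fU z) - ∫ z', (fV z' + fU z') * wY z' ∂τ) * wY z ∂τ)
        - (∫ z, ((fV z - fU z) - ∫ z', (fV z' - fU z') * wV z' ∂τ) * ((fV z + fU z) - ∫ z', (fV z' + fU z') * wV z' ∂τ) * wV z ∂τ)|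
        ≤ K₃)
    -- (JV3′) mirror: transport edge U→W against the law edge W→Y
    (hC' : |(∫ z, ((fW z - fU z) - ∫ z', (fW z' - fU z') * wY z' ∂τ) * ((fW z + fU z) - ∫ z', (fW z' + fU z') * wY z' ∂τ) * wY z ∂τ)
        - (∫ z, ((fW z - fU z) - ∫ z', (fW z' - fU z') * wW z' ∂τ) * ((fW z + fU z) - ∫ z', (fW z' + fU z') * wW z' ∂τ) * wW z ∂τ)|
        ≤ K₃')
    -- (JV4′): the law square on the base observable, own centrings
    (hD : |(∫ z, (fU z - ∫ z', fU z' * wY z' ∂τ) ^ 2 * wY z ∂τ) - (∫ z, (fU z - ∫ z', fU z' * wV z' ∂τ) ^ 2 * wV z ∂τ)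
        - (∫ z, (fU z - ∫ z', fU z' * wW z' ∂τ) ^ 2 * wW z ∂τ) + (∫ z, (fU z - ∫ z', fU z' * wU z' ∂τ) ^ 2 * wU z ∂τ)| ≤ K₄) :
    |(∫ z, (fY z - ∫ z', fY z' * wY z' ∂τ) ^ 2 * wY z ∂τ) - (∫ z, (fV z - ∫ z', fV z' * wV z' ∂τ) ^ 2 * wV z ∂τ)
        - (∫ z, (fW z - ∫ z', fW z' * wW z' ∂τ) ^ 2 * wW z ∂τ) + (∫ z, (fU z - ∫ z', fU z' * wU z' ∂τ) ^ 2 * wU z ∂τ)|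
      ≤ 4 * K₁ + 2 * K₂ + K₃ + K₃' + K₄ := by
  obtain ⟨iAU, bAU⟩ := hA fU (Or.inl rfl)
  obtain ⟨iAV, bAV⟩ := hA fV (Or.inr (Or.inl rfl))
  obtain ⟨iAW, bAW⟩ := hA fW (Or.inr (Or.inr (Or.inl rfl)))
  obtain ⟨iAY, bAY⟩ := hA fY (Or.inr (Or.inr (Or.inr rfl)))
  obtain ⟨iB, bB⟩ := hB
  -- the difference∕sum centrings are differences∕sums of means
  rw [integral_sub_mul_wgt τ fV fU wY hVY hUY, integral_sub_mul_wgt τ fW fU wY hWY hUY] at iB bB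
  rw [integral_sub_mul_wgt τ fV fU wY hVY hUY, integral_add_mul_wgt τ fV fU wY hVY hUY,
    integral_sub_mul_wgt τ fV fU wV hVV hUV, integral_add_mul_wgt τ fV fU wV hVV hUV] at hC
  rw [integral_sub_mul_wgt τ fW fU wY hWY hUY, integral_add_mul_wgt τ fW fU wY hWY hUY,
    integral_sub_mul_wgt τ fW fU wW hWW hUW, integral_add_mul_wgt τ fW fU wW hWW hUW] at hC'
  have h := abs_fibreVar_secondDiff_le τ fU fV fW fY wU wV wW wY
    (∫ z', fU z' * wU z' ∂τ) (∫ z', fU z' * wV z' ∂τ) (∫ z', fU z' * wW z' ∂τ) (∫ z', fU z' * wY z' ∂τ)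
    (∫ z', fV z' * wV z' ∂τ) (∫ z', fV z' * wY z' ∂τ) (∫ z', fW z' * wW z' ∂τ) (∫ z', fW z' * wY z' ∂τ) (∫ z', fY z' * wY z' ∂τ)
    K₁ K₁ K₁ K₁ K₂ K₃ K₃' K₄ hwV hwW hwY hwY1 hUV hUV2 hUW hUW2 hUY hUY2 hVV hVV2 hVY hVY2 hWW hWW2 hWY hWY2 hYY hYY2
    rfl rfl rfl rfl iAY iAV iAW iAU iB bAY bAV bAW bAU bB hC hC' hD
  linarith

end Summit.QuantumFields.YangMills.Theorems.FluctuationComparisonRegPrIntLOrganTangentFibreVarianceRebracket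

end
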